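/-
Copyright (c) 2026. All rights reserved.
Released under Apache 2.0 license as described in the file LICENSE.
-/
import Mathlib.Algebra.BigOperators.Fin
import Mathlib.Data.Nat.Log
import Summits.ValiantsHypothesis.ValiantsHypothesis.Theorems.IsolationRoundStep

/-!
# Isolation rounds: carry-free combination and the isolated survivor

Stage S4b-ii of the O-L2-14 isolation series, after [cite: FennerGurjarThierauf2016, Section 3]:
the rounds of S4b-i `IsolationRoundStep` are iterated and combined.

* §1 `lexVal B [d₀, …, d_{T-1}] = Σ_t d_t · 2^{B (T-1-t)}` (first digit most significant) with the
  carry-free bound `lexVal_lt` and the closed forms `lexVal_ofFn` / `lexVal_map`.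
* §2 `rounds lab G [w₀, …, w_{T-1}]`: the nested minimum faces `nextRel` of S4b-i under the edge
  weights `labWt lab w_t`; admissible sets shrink (`rounds_le`) and stay non-empty
  (`exists_adm_rounds`).
* §3 LEX COMPARISON `lexVal_lt_of_not_adm`: a survivor `σ` of all rounds beats, in the combined
  weight, every `G`-admissible `τ` that drops out at some round — digit by digit through the face
  property `adm_nextRel_iff`, carry-free because every digit of `σ` is `< 2 ^ B`.
* §4 ROUNDS `exists_rounds_girth`: `t` oracle rounds push the girth of the admissible graph above
  `2 · 2 ^ t` (`exists_round` of S4b-i); after `T = log₂ r + 1` rounds no cycle is left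
  (`length_le_card_of_isCycle`, S3), so exactly one admissible permutation survives
  (`perm_unique_of_forall_not_isCycle`, S4a).
* §5 HEADLINE `exists_isolating_rounds`: `T ≤ log₂ r + 1` good weight vectors `w_t < 2 ^ ℓ` whose
  carry-free combination `W μ = Σ_t w_t μ · 2^{B (T-1-t)}` (any `B` with `r · 2 ^ ℓ ≤ 2 ^ B`) gives
  the survivor STRICTLY smaller weight `Σ_k W (lab k (σ k))` than every other `G₀`-admissible
  permutation — the `IsolatesMin` currency of the door `SuccinctTablesValiantCriterion`, which S4c
  reaches for constant-free read-once determinants by realising the oracle with S1 and `W` as the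
  `weightOf` of juxtaposed round circuits.
Currency: kernel-certified helper for the W4 isolation road (stage S4b-ii); closes no item; two data
defs (`lexVal`; `rounds`, relation-valued like `nextRel`), no facts, no doors.
-/

set_option linter.dupNamespace false

namespace Summit.ValiantsHypothesis.ValiantsHypothesis.Theorems.IsolationRounds

open SimpleGraph Summit.ValiantsHypothesis.ValiantsHypothesis.Theorems.ShortCyclePatterns
  Summit.ValiantsHypothesis.ValiantsHypothesis.Theorems.RelationGraphCycles
  Summit.ValiantsHypothesis.ValiantsHypothesis.Theorems.IsolationRoundStep

/-! ### §1 Carry-free positional values -/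

section Lex

/-- `lexVal B [d₀, …, d_{T-1}] = Σ_t d_t · 2 ^ (B · (T-1-t))`, first digit most significant.
[folklore] -/
def lexVal (B : ℕ) : List ℕ → ℕ
  | [] => 0
  | d :: ds => d * 2 ^ (B * ds.length) + lexVal B ds

/-- `lexVal` of the empty digit list. -/
@[simp] theorem lexVal_nil (B : ℕ) : lexVal B [] = 0 := rfl

/-- `lexVal` of a cons: the head digit is the most significant. -/
@[simp] theorem lexVal_cons (B d : ℕ) (ds : List ℕ) :
    lexVal B (d :: ds) = d * 2 ^ (B * ds.length) + lexVal B ds := rfl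

/-- Carry-freeness: digits `< 2 ^ B` give a value `< 2 ^ (B · length)`. -/
theorem lexVal_lt {B : ℕ} : ∀ {ds : List ℕ}, (∀ d ∈ ds, d < 2 ^ B) →
    lexVal B ds < 2 ^ (B * ds.length)
  | [], _ => by simp
  | d :: ds, h => by
    rw [lexVal_cons, List.length_cons]
    have hd : d < 2 ^ B := h d List.mem_cons_self
    have ih := lexVal_lt fun e he => h e (List.mem_cons_of_mem d he)
    calc d * 2 ^ (B * ds.length) + lexVal B ds
        < d * 2 ^ (B * ds.length) + 2 ^ (B * ds.length) := Nat.add_lt_add_left ih _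
      _ = (d + 1) * 2 ^ (B * ds.length) := by ring
      _ ≤ 2 ^ B * 2 ^ (B * ds.length) := Nat.mul_le_mul (Nat.add_one_le_iff.2 hd) le_rfl
      _ = 2 ^ (B * (ds.length + 1)) := by ring

/-- Closed form of `lexVal` on `List.ofFn`. -/
theorem lexVal_ofFn (B n : ℕ) : ∀ f : Fin n → ℕ,
    lexVal B (List.ofFn f) = ∑ t : Fin n, f t * 2 ^ (B * (n - 1 - ↑t)) := by
  induction n with
  | zero => intro f; simp
  | succ n ih =>
    intro f
    rw [List.ofFn_succ, lexVal_cons, List.length_ofFn, ih, Fin.sum_univ_succ]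
    simp only [Fin.val_zero, Fin.val_succ, Nat.add_sub_cancel, Nat.sub_zero]
    congr 1
    refine Finset.sum_congr rfl fun i _ => ?_
    rw [show n - (↑i + 1) = n - 1 - ↑i by omega]

/-- Closed form of `lexVal` on a mapped list. -/
theorem lexVal_map {γ : Type*} (B : ℕ) (d : γ → ℕ) (ws : List γ) :
    lexVal B (ws.map d) =
      ∑ t : Fin ws.length, d (ws.get t) * 2 ^ (B * (ws.length - 1 - ↑t)) := by
  rw [← List.ofFn_getElem_eq_map ws d, lexVal_ofFn]
  simp only [List.get_eq_getElem]

end Lex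

/-! ### §2 Nested minimum faces -/

section Rounds

variable {M : Type*} {r : ℕ}

/-- `rounds lab G [w₀, …, w_{T-1}]`: the relation after `T` rounds — round `t` replaces the current
relation by its minimum face under the edge weights `labWt lab w_t`.
[cite: FennerGurjarThierauf2016, Section 3.2] -/
def rounds (lab : Fin r → Fin r → M) : (Fin r → Fin r → Prop) → List (M → ℕ) → Fin r → Fin r → Prop
  | G, [] => G
  | G, w :: ws => rounds lab (nextRel G (labWt lab w)) ws

/-- No round: the relation is unchanged. -/
@[simp] theorem rounds_nil (lab : Fin r → Fin r → M) (G : Fin r → Fin r → Prop) :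
    rounds lab G [] = G := rfl

/-- The first round takes the minimum face; the remaining rounds act on it. -/
@[simp] theorem rounds_cons (lab : Fin r → Fin r → M) (G : Fin r → Fin r → Prop) (w : M → ℕ)
    (ws : List (M → ℕ)) : rounds lab G (w :: ws) = rounds lab (nextRel G (labWt lab w)) ws := rfl

/-- The last round takes the minimum face of the relation after the earlier rounds. -/
theorem rounds_append (lab : Fin r → Fin r → M) (ws : List (M → ℕ)) (w : M → ℕ) :
    ∀ G : Fin r → Fin r → Prop,
      rounds lab G (ws ++ [w]) = nextRel (rounds lab G ws) (labWt lab w) := by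
  induction ws with
  | nil => intro G; rfl
  | cons w' ws ih => intro G; exact ih _

/-- Rounds only refine the relation. -/
theorem rounds_le (lab : Fin r → Fin r → M) : ∀ (ws : List (M → ℕ))
    {G : Fin r → Fin r → Prop} {i j : Fin r}, rounds lab G ws i j → G i j
  | [], _, _, _, h => h
  | w :: ws, G, _, _, h => nextRel_le G (labWt lab w) (rounds_le lab ws h)

/-- Admissible sets stay non-empty through the rounds. -/
theorem exists_adm_rounds (lab : Fin r → Fin r → M) : ∀ (ws : List (M → ℕ))
    {G : Fin r → Fin r → Prop} {σ : Equiv.Perm (Fin r)}, (∀ k, G k (σ k)) →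
      ∃ σ' : Equiv.Perm (Fin r), ∀ k, rounds lab G ws k (σ' k)
  | [], _, σ, hσ => ⟨σ, hσ⟩
  | w :: ws, G, _, hσ => by
    obtain ⟨σ₀, h₀, hmin⟩ := exists_min_adm G (labWt lab w) hσ
    exact exists_adm_rounds lab ws (adm_nextRel_of_min h₀ hmin)

/-! ### §3 Lexicographic comparison -/

/-- A survivor of all rounds beats, carry-free, every admissible permutation that drops out.
[cite: FennerGurjarThierauf2016, Lemma 3.8] -/
theorem lexVal_lt_of_not_adm (lab : Fin r → Fin r → M) {B : ℕ} : ∀ (ws : List (M → ℕ))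
    {G : Fin r → Fin r → Prop} {σ τ : Equiv.Perm (Fin r)},
      (∀ k, rounds lab G ws k (σ k)) → (∀ k, G k (τ k)) → (¬ ∀ k, rounds lab G ws k (τ k)) →
      (∀ w ∈ ws, ∑ k, w (lab k (σ k)) < 2 ^ B) →
      lexVal B (ws.map fun w => ∑ k, w (lab k (σ k))) <
        lexVal B (ws.map fun w => ∑ k, w (lab k (τ k)))
  | [], _, _, _, hσ, hτ, hτn, _ => absurd hτ (by simpa using hτn)
  | w :: ws, G, σ, τ, hσ, hτ, hτn, hB => by
    rw [rounds_cons] at hσ hτn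
    have hσ₁ : ∀ k, nextRel G (labWt lab w) k (σ k) := fun k => rounds_le lab ws (hσ k)
    obtain ⟨hσG, hσmin⟩ := adm_nextRel_iff.1 hσ₁
    simp only [labWt_apply] at hσmin
    have hrest : lexVal B (ws.map fun w => ∑ k, w (lab k (σ k))) < 2 ^ (B * ws.length) := by
      have h := lexVal_lt (B := B) (ds := ws.map fun w => ∑ k, w (lab k (σ k))) fun d hd => by
        obtain ⟨w', hw', rfl⟩ := List.mem_map.1 hd
        exact hB w' (List.mem_cons_of_mem _ hw')
      rwa [List.length_map] at h
    simp only [List.map_cons, lexVal_cons, List.length_map]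
    by_cases hτ₁ : ∀ k, nextRel G (labWt lab w) k (τ k)
    · obtain ⟨-, hτmin⟩ := adm_nextRel_iff.1 hτ₁
      simp only [labWt_apply] at hτmin
      have heq : ∑ k, w (lab k (σ k)) = ∑ k, w (lab k (τ k)) :=
        le_antisymm (hσmin τ hτ) (hτmin σ hσG)
      have ih := lexVal_lt_of_not_adm lab ws hσ hτ₁ hτn fun w' hw' =>
        hB w' (List.mem_cons_of_mem _ hw')
      rw [heq]
      exact Nat.add_lt_add_left ih _
    · have hlt : ∑ k, w (lab k (σ k)) < ∑ k, w (lab k (τ k)) := by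
        by_contra hge
        push Not at hge
        refine hτ₁ (adm_nextRel_of_min hτ fun ρ hρ => ?_)
        simp only [labWt_apply]
        exact hge.trans (hσmin ρ hρ)
      calc (∑ k, w (lab k (σ k))) * 2 ^ (B * ws.length) +
            lexVal B (ws.map fun w => ∑ k, w (lab k (σ k)))
          < (∑ k, w (lab k (σ k))) * 2 ^ (B * ws.length) + 2 ^ (B * ws.length) :=
            Nat.add_lt_add_left hrest _
        _ = (∑ k, w (lab k (σ k)) + 1) * 2 ^ (B * ws.length) := by ring
        _ ≤ (∑ k, w (lab k (τ k))) * 2 ^ (B * ws.length) :=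
            Nat.mul_le_mul (Nat.add_one_le_iff.2 hlt) le_rfl
        _ ≤ (∑ k, w (lab k (τ k))) * 2 ^ (B * ws.length) +
            lexVal B (ws.map fun w => ∑ k, w (lab k (τ k))) := Nat.le_add_right _ _

/-! ### §4 Rounds with an oracle -/

variable [Fintype M] [DecidableEq M]

/-- `t` oracle rounds push the girth bound of the admissible graph to `2 · 2 ^ t`. -/
theorem exists_rounds_girth {G₀ : Fin r → Fin r → Prop} {lab : Fin r → Fin r → M}
    {Good : (M → ℕ) → Prop} {ℓ : ℕ}
    (hlab : ∀ i j i' j', G₀ i j → G₀ i' j' → lab i j = lab i' j' → i = i' ∧ j = j')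
    (horacle : ∀ S : Finset (M → ℤ), S.card ≤ (r + r) ^ 4 → (∀ π ∈ S, π ≠ 0) →
      (∀ π ∈ S, ∀ μ, (π μ).natAbs ≤ 1) →
      ∃ w : M → ℕ, Good w ∧ (∀ μ, w μ < 2 ^ ℓ) ∧ ∀ π ∈ S, ∑ μ, π μ * (w μ : ℤ) ≠ 0) :
    ∀ t : ℕ, ∃ ws : List (M → ℕ), ws.length = t ∧ (∀ w ∈ ws, Good w ∧ ∀ μ, w μ < 2 ^ ℓ) ∧
      ∀ (u : Fin r ⊕ Fin r) (c : (relGraph (rounds lab G₀ ws)).Walk u u), c.IsCycle →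
        2 * 2 ^ t < c.length
  | 0 => ⟨[], rfl, fun _ hw => absurd hw List.not_mem_nil, fun u c hc => by
      have h3 := hc.three_le_length
      rw [pow_zero, mul_one]
      omega⟩
  | t + 1 => by
    obtain ⟨ws, hlen, hws, hg⟩ := exists_rounds_girth hlab horacle t
    have hGG₀ : ∀ i j, rounds lab G₀ ws i j → G₀ i j := fun i j h => rounds_le lab ws h
    obtain ⟨w, hgood, hlt, hg'⟩ := exists_round hlab horacle hGG₀ hg
    refine ⟨ws ++ [w], by rw [List.length_append, List.length_singleton, hlen], fun w' hw' => ?_,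
      ?_⟩
    · rw [List.mem_append, List.mem_singleton] at hw'
      rcases hw' with hw' | rfl
      · exact hws w' hw'
      · exact ⟨hgood, hlt⟩
    · rw [rounds_append]
      intro u c hc
      have h := hg' u c hc
      rw [pow_succ]
      omega

/-! ### §5 The isolated survivor -/

omit [Fintype M] [DecidableEq M] in
/-- The combined weight of a permutation is the positional value of its digit list. -/
theorem sum_sum_get_mul_eq_lexVal (lab : Fin r → Fin r → M) (ws : List (M → ℕ))
    (ρ : Equiv.Perm (Fin r)) (B : ℕ) :
    ∑ k, ∑ t : Fin ws.length, ws.get t (lab k (ρ k)) * 2 ^ (B * (ws.length - 1 - ↑t)) =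
      lexVal B (ws.map fun w => ∑ k, w (lab k (ρ k))) := by
  rw [lexVal_map, Finset.sum_comm]
  exact Finset.sum_congr rfl fun t _ => (Finset.sum_mul _ _ _).symm

/-- SUCCINCT ISOLATION ROUNDS (abstract form of [cite: FennerGurjarThierauf2016, Section 3]).
Let `lab` be a READ-ONCE labelling of the relation `G₀` on `Fin r` by variables `M` (injective on
`G₀`), and suppose an ORACLE answers every family of at most `(r + r) ^ 4` non-zero height-`≤ 1`
patterns `π : M → ℤ` with GOOD weights `w < 2 ^ ℓ` such that `Σ_μ π μ · w μ ≠ 0` for all members.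
If `G₀` is admissible at all, then there are `T ≤ log₂ r + 1` good weight vectors `w_t < 2 ^ ℓ`
and a `G₀`-admissible `σ` such that for every `B` with `r · 2 ^ ℓ ≤ 2 ^ B` the combined weight
`W μ = Σ_t w_t μ · 2 ^ (B (T-1-t))` gives `σ` strictly smaller weight `Σ_k W (lab k (σ k))` than
every other `G₀`-admissible permutation. -/
theorem exists_isolating_rounds {G₀ : Fin r → Fin r → Prop} {lab : Fin r → Fin r → M}
    {Good : (M → ℕ) → Prop} {ℓ : ℕ}
    (hlab : ∀ i j i' j', G₀ i j → G₀ i' j' → lab i j = lab i' j' → i = i' ∧ j = j')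
    (horacle : ∀ S : Finset (M → ℤ), S.card ≤ (r + r) ^ 4 → (∀ π ∈ S, π ≠ 0) →
      (∀ π ∈ S, ∀ μ, (π μ).natAbs ≤ 1) →
      ∃ w : M → ℕ, Good w ∧ (∀ μ, w μ < 2 ^ ℓ) ∧ ∀ π ∈ S, ∑ μ, π μ * (w μ : ℤ) ≠ 0)
    (hadm : ∃ σ : Equiv.Perm (Fin r), ∀ k, G₀ k (σ k)) :
    ∃ (T : ℕ) (ws : Fin T → M → ℕ), T ≤ Nat.log 2 r + 1 ∧ (∀ t, Good (ws t)) ∧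
      (∀ t μ, ws t μ < 2 ^ ℓ) ∧ ∃ σ : Equiv.Perm (Fin r), (∀ k, G₀ k (σ k)) ∧
        ∀ B : ℕ, r * 2 ^ ℓ ≤ 2 ^ B → ∀ τ : Equiv.Perm (Fin r), (∀ k, G₀ k (τ k)) → τ ≠ σ →
          ∑ k, ∑ t, ws t (lab k (σ k)) * 2 ^ (B * (T - 1 - ↑t)) <
            ∑ k, ∑ t, ws t (lab k (τ k)) * 2 ^ (B * (T - 1 - ↑t)) := by
  obtain ⟨ws, hlen, hws, hg⟩ := exists_rounds_girth hlab horacle (Nat.log 2 r + 1)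
  have hnoc : ∀ (u : Fin r ⊕ Fin r) (c : (relGraph (rounds lab G₀ ws)).Walk u u), ¬ c.IsCycle := by
    intro u c hc
    have h1 := hg u c hc
    have h2 := length_le_card_of_isCycle hc
    rw [Fintype.card_sum, Fintype.card_fin] at h2
    have h3 : r < 2 ^ (Nat.log 2 r + 1) := Nat.lt_pow_succ_log_self (by decide) r
    omega
  obtain ⟨σ₀, hσ₀⟩ := hadm
  obtain ⟨σ, hσ⟩ := exists_adm_rounds lab ws hσ₀
  refine ⟨ws.length, ws.get, hlen.le, fun t => (hws _ (List.get_mem ws t)).1,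
    fun t μ => (hws _ (List.get_mem ws t)).2 μ, σ, fun k => rounds_le lab ws (hσ k),
    fun B hB τ hτ hne => ?_⟩
  have hτn : ¬ ∀ k, rounds lab G₀ ws k (τ k) := fun hτ' =>
    hne (perm_unique_of_forall_not_isCycle _ hnoc hτ' hσ)
  have hdig : ∀ w ∈ ws, ∑ k, w (lab k (σ k)) < 2 ^ B := by
    intro w hw
    rcases Nat.eq_zero_or_pos r with hr | hr
    · subst hr
      simp only [Finset.univ_eq_empty, Finset.sum_empty]
      exact Nat.two_pow_pos B
    · calc ∑ k, w (lab k (σ k)) < ∑ _k : Fin r, 2 ^ ℓ :=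
            Finset.sum_lt_sum_of_nonempty ⟨⟨0, hr⟩, Finset.mem_univ _⟩ fun k _ => (hws w hw).2 _
        _ = r * 2 ^ ℓ := by
            rw [Finset.sum_const, Finset.card_univ, Fintype.card_fin, smul_eq_mul]
        _ ≤ 2 ^ B := hB
  rw [sum_sum_get_mul_eq_lexVal lab ws σ B, sum_sum_get_mul_eq_lexVal lab ws τ B]
  exact lexVal_lt_of_not_adm lab ws hσ hτ hτn hdig

end Rounds

end Summit.ValiantsHypothesis.ValiantsHypothesis.Theorems.IsolationRounds
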